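import Mathlib.Algebra.Group.Basic
import Mathlib.Data.Fintype.Card
import Mathlib.Data.Fintype.Prod
import Mathlib.Data.Finset.Card
import Mathlib.Tactic
import HarnessLib

/-!
# Venture HSemireg — pairs of non-identity elements with prescribed product (the core isotypic count)

HONEST FRAMING. Elementary finite-group counting; no variety, sheaf or spectral sequence is constructed here and
nothing here says that HC, HC_CM or HC_AV holds. This is the count behind the «+1» of the census counts law
(COUNTS-LAW-t26g17 §2, Lemma 4; SLOTS-COLRANK-t26g16 S14χ «non-trivial eigenspaces have dimension base + 1»):
on the pure core the slice class space is `V₀ ⊗ V₀ ⊗ V₀` with `V₀ = ⊕_{ψ ≠ 1} ψ` the augmentation module of the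
level subgroup `H` (cyclic of order `m`), so the multiplicity of a character `χ` in it is the number of triples
`(ψ₁, ψ₂, ψ₃)` of non-trivial characters with `ψ₁ ψ₂ ψ₃ = χ`, i.e. the number of pairs `(ψ₁, ψ₂)` of non-trivial
characters with `ψ₁ ψ₂ ≠ χ` (then `ψ₃` is determined and non-trivial). For any finite group `G` of order `m` and
`g : G` this number is `(m - 1)^2 - (m - 2)` if `g ≠ 1` and `(m - 1) (m - 2)` if `g = 1` — the model's
`K̄ + 1 = m² − 3m + 3` classes per non-trivial character and `K̄ = (m−1)(m−2)` invariant classes on the core,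
summing to `(m - 1)^3`.

CONTENT (`G` a finite group, `g : G`, everything as `Finset.card` of filters of `univ : Finset (G × G)`):
* `card_pairs_ne_one` — `#{(x, y) : x ≠ 1 ∧ y ≠ 1} = (card G - 1)^2`;
* `card_pairs_ne_one_mul_eq_add` — `#{(x, y) : x ≠ 1 ∧ y ≠ 1 ∧ x y = g} + (if g = 1 then 1 else 2) = card G`;
* `card_pairs_ne_one_mul_ne_add` — `#{… ∧ x y ≠ g} + #{… ∧ x y = g} = (card G - 1)^2`;
* `card_pairs_ne_one_mul_ne_of_ne_one` ∕ `card_pairs_ne_one_mul_ne_one` — the two closed forms.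
-/

namespace Summit.Ventures.HSemireg

open Finset

variable {G : Type*} [Group G] [Fintype G] [DecidableEq G]

/-- The pairs of non-identity elements of a finite group: `(card G - 1)^2` of them. -/
theorem card_pairs_ne_one :
    (univ.filter fun p : G × G => p.1 ≠ 1 ∧ p.2 ≠ 1).card = (Fintype.card G - 1) ^ 2 := by
  have h : (univ.filter fun p : G × G => p.1 ≠ 1 ∧ p.2 ≠ 1) = (univ.erase (1 : G)) ×ˢ (univ.erase (1 : G)) := by
    ext p
    simp only [mem_filter, mem_univ, true_and, mem_product, mem_erase, and_true]
  rw [h, card_product, card_erase_of_mem (mem_univ _), card_univ, sq]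

/-- Pairs of non-identity elements with product EQUAL to `g`: they are in bijection (first coordinate) with the
elements `x ∉ {1, g}`, so there are `card G - 1` of them if `g = 1` and `card G - 2` otherwise; stated additively. -/
theorem card_pairs_ne_one_mul_eq_add (g : G) :
    (univ.filter fun p : G × G => p.1 ≠ 1 ∧ p.2 ≠ 1 ∧ p.1 * p.2 = g).card + (if g = 1 then 1 else 2)
      = Fintype.card G := by
  -- first coordinate is a bijection onto {x | x ≠ 1 ∧ x ≠ g}
  have hbij : (univ.filter fun p : G × G => p.1 ≠ 1 ∧ p.2 ≠ 1 ∧ p.1 * p.2 = g).card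
      = (univ.filter fun x : G => x ≠ 1 ∧ x ≠ g).card := by
    refine card_bij (fun p _ => p.1) ?_ ?_ ?_
    · intro p hp
      simp only [mem_filter, mem_univ, true_and] at hp ⊢
      refine ⟨hp.1, ?_⟩
      intro hx
      apply hp.2.1
      -- x = g and x * y = g ⇒ y = 1
      have : p.1 * p.2 = p.1 * 1 := by rw [mul_one, hp.2.2, hx]
      exact mul_left_cancel this
    · intro p hp q hq h
      simp only [mem_filter, mem_univ, true_and] at hp hq
      -- same first coordinate and same product ⇒ same second coordinate
      have h2 : p.2 = q.2 := by
        have : p.1 * p.2 = p.1 * q.2 := by rw [hp.2.2, h, hq.2.2]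
        exact mul_left_cancel this
      exact Prod.ext h h2
    · intro x hx
      simp only [mem_filter, mem_univ, true_and] at hx
      refine ⟨(x, x⁻¹ * g), ?_, rfl⟩
      simp only [mem_filter, mem_univ, true_and]
      refine ⟨hx.1, ?_, by rw [mul_inv_cancel_left]⟩
      intro h
      apply hx.2
      -- x⁻¹ * g = 1 ⇒ x = g
      have := congrArg (fun z => x * z) h
      simpa [mul_inv_cancel_left] using this.symm
  rw [hbij]
  -- count {x | x ≠ 1 ∧ x ≠ g} = card G - card {1, g}
  have hset : (univ.filter fun x : G => x ≠ 1 ∧ x ≠ g) = univ \ ({1, g} : Finset G) := by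
    ext x
    simp only [mem_filter, mem_univ, true_and, mem_sdiff, mem_insert, mem_singleton, not_or]
  have hcard : ({1, g} : Finset G).card = (if g = 1 then 1 else 2) := by
    split_ifs with hg
    · rw [hg, pair_eq_singleton, card_singleton]  -- {1, 1} = {1}
    · rw [card_pair (Ne.symm hg)]
  rw [hset, ← hcard, card_sdiff_add_card_eq_card (subset_univ _), card_univ]

/-- Splitting the non-identity pairs by whether the product is `g`. -/
theorem card_pairs_ne_one_mul_ne_add (g : G) :
    (univ.filter fun p : G × G => p.1 ≠ 1 ∧ p.2 ≠ 1 ∧ p.1 * p.2 ≠ g).card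
      + (univ.filter fun p : G × G => p.1 ≠ 1 ∧ p.2 ≠ 1 ∧ p.1 * p.2 = g).card = (Fintype.card G - 1) ^ 2 := by
  rw [← card_pairs_ne_one (G := G)]
  rw [← card_union_of_disjoint]
  · congr 1
    ext p
    simp only [mem_union, mem_filter, mem_univ, true_and]
    tauto
  · rw [disjoint_filter]
    intro p _ hp hq
    exact hp.2.2 hq.2.2

/-- **The core isotypic count, non-trivial character.** In a finite group of order `m`, for `g ≠ 1` the number of
pairs `(x, y)` with `x ≠ 1`, `y ≠ 1`, `x y ≠ g` is `(m - 1)^2 - (m - 2)` (`= m² − 3m + 3`, the model's `K̄ + 1` on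
the core). [COUNTS-LAW-t26g17 §2 Lemma 4] -/
theorem card_pairs_ne_one_mul_ne_of_ne_one {g : G} (hg : g ≠ 1) :
    (univ.filter fun p : G × G => p.1 ≠ 1 ∧ p.2 ≠ 1 ∧ p.1 * p.2 ≠ g).card
      = (Fintype.card G - 1) ^ 2 - (Fintype.card G - 2) := by
  have h1 := card_pairs_ne_one_mul_ne_add g
  have h2 := card_pairs_ne_one_mul_eq_add g
  rw [if_neg hg] at h2
  omega

/-- **The core isotypic count, trivial character.** In a finite group of order `m` the number of pairs `(x, y)` with
`x ≠ 1`, `y ≠ 1`, `x y ≠ 1` is `(m - 1) (m - 2)` (the model's `K̄ = (m−1)(m−2)` invariant classes on the core).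
[COUNTS-LAW-t26g17 §2 Lemma 4] -/
theorem card_pairs_ne_one_mul_ne_one :
    (univ.filter fun p : G × G => p.1 ≠ 1 ∧ p.2 ≠ 1 ∧ p.1 * p.2 ≠ 1).card
      = (Fintype.card G - 1) * (Fintype.card G - 2) := by
  have h1 := card_pairs_ne_one_mul_ne_add (1 : G)
  have h2 := card_pairs_ne_one_mul_eq_add (1 : G)
  rw [if_pos rfl] at h2
  -- (m-1)^2 = (m-1)(m-2) + (m-1), as n^2 = n(n-1) + n with n = m - 1
  have key : ∀ n : ℕ, n ^ 2 = n * (n - 1) + n := by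
    intro n
    rcases n with _ | k
    · simp
    · rw [Nat.add_sub_cancel, sq]; ring
  have h3 : Fintype.card G - 2 = (Fintype.card G - 1) - 1 := by omega
  rw [h3]
  have h4 := key (Fintype.card G - 1)
  omega

end Summit.Ventures.HSemireg
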